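import Mathlib
import HarnessLib
import Summits.Ventures.LatticeQCDFlow.Scaling.AutoregressiveGaugePlaquetteReads

/-!
# LatticeQCDFlow / Scaling — HAAR IS THE BEST STAPLE-BLIND PROPOSAL: a conditional law for a gauge link that
# ignores the link across an integrated corner is at least as far from the exact conditional as the prior

HONEST FRAMING: exact (Metropolis-corrected) sampling algorithms for lattice gauge theory;
figures of merit are autocorrelation/cost numbers at stated couplings and volumes; no
continuum-physics claim.

Venture `LatticeQCDFlow` (cell pub-lqcd), topic `Scaling`, FANOUT row 30 (lean-1, GEN-18) — OUR WORK for
THEORY-2 §4 row C5 (gauge case: what an EXACT autoregressive conditioner for a gauge link must read, and what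
it costs not to).  Any dimension `d`, volume `L`, compact group `G` (Haar probability `μ`, product `π = μ^{⊗E}`),
bounded measurable gauge-invariant weight `F` (e.g. `e^{−βS_W}`), integrated links `s`, a site `y` whose links
outside `s` are exactly `ℓ₁` (arriving) and `ℓ₂` (leaving) — e.g. the closing link of a plaquette and the next
staple link when everything off the plaquette is integrated.  `N = A_s F`, `M = A_{insert ℓ₁ s} F`; `N/M` is
the exact conditional density of `U_{ℓ₁}` given the retained links.  A PROPOSAL for `U_{ℓ₁}` is a bounded
measurable `q ≥ 0`-type density (w.r.t. Haar in the `ℓ₁` coordinate, `∫ q(U[ℓ₁ ↦ v]) dv = 1`) that may read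
every link except `ℓ₂` (`q(U[ℓ₂ ↦ v]) = q(U)`).

* **`integral_abs_sub_le_of_blindProposal`** — `∫ |N − M| dπ ≤ ∫ |N − q·M| dπ`: in Wilson-weighted `L¹`
  (equivalently: in the average, under the normalised weight, of the total-variation distance of conditional
  laws) NO `ℓ₂`-blind proposal beats the Haar prior `q ≡ 1`.  Proof: the corner move
  `T_g : U ↦ U[ℓ₁ ↦ U_{ℓ₁}g⁻¹][ℓ₂ ↦ gU_{ℓ₂}]` preserves `π`, `N` and `M` (tree `coordAvg_pathHolonomy`) and turns
  `q` into `q(U[ℓ₁ ↦ U_{ℓ₁}g⁻¹])`; averaging over `g` (Fubini, `|∫·| ≤ ∫|·|`) replaces `q` by its `ℓ₁`-average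
  `1`.

READING (value-free): combined with `Scaling/AutoregressiveGaugePlaquetteMarginal` (`∫|N − M| ≥
(1/N_dim)∫Re tr ρ(U_p)e^{−βS_W} = Z·⟨W_{1×1}⟩_β`): for every compact gauge group with a non-trivial central scalar,
every dimension and volume, an autoregressive conditioner for a link that ignores even ONE link of the staple —
however it uses all other links — is on average at total-variation distance `≥ ⟨W_{1×1}⟩_β/2` from the exact
conditional (`→ ½` at weak coupling, volume-uniformly): staple-blindness costs a macroscopic, β-independent-order
rejection rate per link in any exact (Metropolis-corrected) scheme built on it.  NOT CLAIMED: proposals reading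
`ℓ₂`; sharper constants; any number of ours.  Elementary over the parents; no `def`; nothing is cited as a
fact; no `sorry`.
-/

noncomputable section

namespace Summit.Ventures.LatticeQCDFlow.Theory2.Autoregressive

open MeasureTheory Function Set
open Literature.MathematicalPhysics.QuantumFieldTheory
open Summit.Ventures.LatticeQCDFlow.Exactness

variable {d L : ℕ} {G : Type*} [Group G] [TopologicalSpace G] [IsTopologicalGroup G] [CompactSpace G]
  [SecondCountableTopology G] [MeasurableSpace G] [BorelSpace G] [NeZero L]

/-- **HAAR IS THE BEST `ℓ₂`-BLIND PROPOSAL.**  At a site `y` whose links outside `s` are exactly `ℓ₁`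
(arriving) and `ℓ₂` (leaving), for a bounded measurable gauge-invariant weight `F`, `N = A_s F`,
`M = A_{insert ℓ₁ s} F`, and any bounded measurable `q` blind to `ℓ₂` with `∫ q(U[ℓ₁ ↦ v]) dv = 1` for all `U`:
`∫ |N − M| dπ ≤ ∫ |N − q·M| dπ`. [ours] -/
theorem integral_abs_sub_le_of_blindProposal (s : Finset (Edge d L)) {F : GaugeConfig d L G → ℝ}
    (hF : IsGaugeInvariant F) (hFm : Measurable F) (hFb : ∃ C, ∀ U, |F U| ≤ C)
    {y : Site d L} {ℓ₁ ℓ₂ : Edge d L} (hne : ℓ₁ ≠ ℓ₂) (h₁ : ℓ₁.1.shift ℓ₁.2 = y) (h₁' : ℓ₁.1 ≠ y)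
    (h₂ : ℓ₂.1 = y) (h₂' : ℓ₂.1.shift ℓ₂.2 ≠ y)
    (hstar : ∀ e : Edge d L, e.1 = y ∨ e.1.shift e.2 = y → e ≠ ℓ₁ → e ≠ ℓ₂ → e ∈ s)
    {q : GaugeConfig d L G → ℝ} (hqm : Measurable q) (hqb : ∃ C, ∀ U, |q U| ≤ C)
    (hq₂ : ∀ U v, q (update U ℓ₂ v) = q U)
    (hq1 : ∀ U, ∫ v, q (update U ℓ₁ v) ∂(haarProbability G) = 1) :
    ∫ U, |coordAvg (haarProbability G) s F U - coordAvg (haarProbability G) (insert ℓ₁ s) F U|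
        ∂Measure.pi (fun _ : Edge d L => haarProbability G) ≤
      ∫ U, |coordAvg (haarProbability G) s F U - q U * coordAvg (haarProbability G) (insert ℓ₁ s) F U|
        ∂Measure.pi (fun _ : Edge d L => haarProbability G) := by
  classical
  set μ := haarProbability G with hμ
  set π := Measure.pi (fun _ : Edge d L => μ) with hπ
  set N := coordAvg μ s F with hN
  set M := coordAvg μ (insert ℓ₁ s) F with hM
  obtain ⟨CF, hCF⟩ := hFb
  obtain ⟨Cq, hCq⟩ := hqb
  -- bounds and measurability of `N`, `M`
  have hFlo : ∀ U, -CF ≤ F U := fun U => (abs_le.1 (hCF U)).1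
  have hFhi : ∀ U, F U ≤ CF := fun U => (abs_le.1 (hCF U)).2
  have hNb : ∀ U, |N U| ≤ CF := fun U => abs_le.2 (coordAvg_mem_Icc μ s hFm hFlo hFhi U)
  have hMb : ∀ U, |M U| ≤ CF := fun U => abs_le.2 (coordAvg_mem_Icc μ (insert ℓ₁ s) hFm hFlo hFhi U)
  have hNm : Measurable N := measurable_coordAvg μ s hFm
  have hMm : Measurable M := measurable_coordAvg μ (insert ℓ₁ s) hFm
  have hCq0 : 0 ≤ Cq := (abs_nonneg _).trans (hCq 1)
  have hCF0 : 0 ≤ CF := (abs_nonneg _).trans (hCF 1)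
  -- the corner move `T_g`
  let T : G → (GaugeConfig d L G ≃ᵐ GaugeConfig d L G) := fun g =>
    MeasurableEquiv.piCongrRight fun e =>
      if e = ℓ₁ then MeasurableEquiv.mulRight g⁻¹
      else if e = ℓ₂ then MeasurableEquiv.mulLeft g else MeasurableEquiv.refl G
  have hT : ∀ (g : G) (U : GaugeConfig d L G),
      T g U = update (update U ℓ₁ (U ℓ₁ * g⁻¹)) ℓ₂ (g * U ℓ₂) := by
    intro g U
    funext e
    by_cases he2 : e = ℓ₂
    · subst he2
      simp [T, MeasurableEquiv.piCongrRight, hne.symm]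
    · by_cases he1 : e = ℓ₁
      · subst he1
        simp [T, MeasurableEquiv.piCongrRight, update_of_ne hne]
      · simp [T, MeasurableEquiv.piCongrRight, he1, he2]
  have hTmp : ∀ g : G, MeasurePreserving (T g) π π := by
    intro g
    refine measurePreserving_pi (fun _ : Edge d L => μ) (fun _ : Edge d L => μ) fun e => ?_
    by_cases he1 : e = ℓ₁
    · subst he1
      simpa using measurePreserving_mul_right μ g⁻¹
    · by_cases he2 : e = ℓ₂
      · subst he2
        simpa [he1] using measurePreserving_mul_left μ g
      · simpa [he1, he2] using MeasurePreserving.id μ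
  -- invariance of `N`, `M`; effect on `q`
  have hNT : ∀ g U, N (T g U) = N U := fun g U => by
    rw [hT]; exact coordAvg_pathHolonomy hF hne h₁ h₁' h₂ h₂' hstar U g
  have hMT : ∀ g U, M (T g U) = M U := fun g U => by
    rw [hT]
    exact coordAvg_pathHolonomy hF hne h₁ h₁' h₂ h₂'
      (fun e he h1 h2 => Finset.mem_insert_of_mem (hstar e he h1 h2)) U g
  have hqT : ∀ g U, q (T g U) = q (update U ℓ₁ (U ℓ₁ * g⁻¹)) := fun g U => by rw [hT, hq₂]
  -- the integrand after the move, as a function of `(g, U)`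
  set φ : G → GaugeConfig d L G → ℝ := fun g U => |N U - q (update U ℓ₁ (U ℓ₁ * g⁻¹)) * M U| with hφ
  -- Step 1: for every `g` the integral is unchanged by the move
  have hstep1 : ∀ g : G, ∫ U, |N U - q U * M U| ∂π = ∫ U, φ g U ∂π := by
    intro g
    have h := (hTmp g).integral_comp' (fun U => |N U - q U * M U|)
    rw [← h]
    refine integral_congr_ae (ae_of_all _ fun U => ?_)
    show |N (T g U) - q (T g U) * M (T g U)| = |N U - q (update U ℓ₁ (U ℓ₁ * g⁻¹)) * M U|
    rw [hNT, hMT, hqT]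
  -- measurability of `(g, U) ↦ U[ℓ₁ ↦ U_{ℓ₁} g⁻¹]`
  have hupd : Measurable fun p : G × GaugeConfig d L G => update p.2 ℓ₁ (p.2 ℓ₁ * p.1⁻¹) := by
    refine measurable_pi_lambda _ fun e => ?_
    by_cases he : e = ℓ₁
    · subst he
      simp only [update_self]
      exact ((measurable_pi_apply _).comp measurable_snd).mul measurable_fst.inv
    · simp only [update_of_ne he]
      exact (measurable_pi_apply e).comp measurable_snd
  have hφm : Measurable (uncurry φ) := by
    have h1 : Measurable fun p : G × GaugeConfig d L G => N p.2 := hNm.comp measurable_snd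
    have h2 : Measurable fun p : G × GaugeConfig d L G => q (update p.2 ℓ₁ (p.2 ℓ₁ * p.1⁻¹)) :=
      hqm.comp hupd
    have h3 : Measurable fun p : G × GaugeConfig d L G => M p.2 := hMm.comp measurable_snd
    exact (h1.sub (h2.mul h3)).abs
  have hφb : ∀ g U, |φ g U| ≤ CF + Cq * CF := by
    intro g U
    simp only [hφ, abs_abs]
    calc |N U - q (update U ℓ₁ (U ℓ₁ * g⁻¹)) * M U|
        ≤ |N U| + |q (update U ℓ₁ (U ℓ₁ * g⁻¹)) * M U| := abs_sub _ _
      _ ≤ CF + Cq * CF := by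
          rw [abs_mul]; exact add_le_add (hNb U) (mul_le_mul (hCq _) (hMb U) (abs_nonneg _) hCq0)
  have hφi : Integrable (uncurry φ) (μ.prod π) :=
    Integrable.mono' (integrable_const _) hφm.aestronglyMeasurable
      (ae_of_all _ fun p => by rw [Real.norm_eq_abs]; exact hφb p.1 p.2)
  -- Step 2: average over `g` and swap the integrals
  have hstep2 : ∫ U, |N U - q U * M U| ∂π = ∫ U, ∫ g, φ g U ∂μ ∂π := by
    have hconst : ∫ g, (∫ U, |N U - q U * M U| ∂π) ∂μ = ∫ U, |N U - q U * M U| ∂π := by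
      rw [integral_const, Measure.real, measure_univ, ENNReal.toReal_one, one_smul]
    rw [← hconst, integral_congr_ae (ae_of_all _ fun g => hstep1 g)]
    exact integral_integral_swap hφi
  -- Step 3: `∫_G q(U[ℓ₁ ↦ U_{ℓ₁}g⁻¹]) dg = 1`
  have havg : ∀ U : GaugeConfig d L G, ∫ g, q (update U ℓ₁ (U ℓ₁ * g⁻¹)) ∂μ = 1 := by
    intro U
    have h1 := integral_inv_eq_self (fun g : G => q (update U ℓ₁ (U ℓ₁ * g))) μ
    rw [h1, integral_mul_left_eq_self (fun v => q (update U ℓ₁ v)) (U ℓ₁), hq1]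
  -- Step 4: pointwise `|N − M| ≤ ∫_G φ g U dg`
  have hinner : ∀ U : GaugeConfig d L G, |N U - M U| ≤ ∫ g, φ g U ∂μ := by
    intro U
    have hqi : Integrable (fun g : G => q (update U ℓ₁ (U ℓ₁ * g⁻¹))) μ := by
      refine Integrable.mono' (integrable_const Cq) ?_ (ae_of_all _ fun g => by
        rw [Real.norm_eq_abs]; exact hCq _)
      exact (hqm.comp (hupd.comp (measurable_id.prodMk measurable_const))).aestronglyMeasurable
    have hlin : ∫ g, (N U - q (update U ℓ₁ (U ℓ₁ * g⁻¹)) * M U) ∂μ = N U - M U := by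
      rw [integral_sub (integrable_const _) (hqi.mul_const _), integral_const, integral_mul_const, havg U,
        Measure.real, measure_univ, ENNReal.toReal_one, one_smul, one_mul]
    calc |N U - M U| = |∫ g, (N U - q (update U ℓ₁ (U ℓ₁ * g⁻¹)) * M U) ∂μ| := by rw [hlin]
      _ = ‖∫ g, (N U - q (update U ℓ₁ (U ℓ₁ * g⁻¹)) * M U) ∂μ‖ := (Real.norm_eq_abs _).symm
      _ ≤ ∫ g, ‖N U - q (update U ℓ₁ (U ℓ₁ * g⁻¹)) * M U‖ ∂μ := norm_integral_le_integral_norm _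
      _ = ∫ g, φ g U ∂μ := by simp only [hφ, Real.norm_eq_abs]
  -- Step 5: integrate Step 4
  have hli : Integrable (fun U => |N U - M U|) π :=
    Integrable.mono' (integrable_const (CF + CF)) ((hNm.sub hMm).abs.aestronglyMeasurable)
      (ae_of_all _ fun U => by
        rw [Real.norm_eq_abs, abs_abs]
        exact (abs_sub _ _).trans (add_le_add (hNb U) (hMb U)))
  have hri : Integrable (fun U => ∫ g, φ g U ∂μ) π := MeasureTheory.Integrable.integral_prod_right hφi
  rw [hstep2]
  exact integral_mono hli hri hinner

end Summit.Ventures.LatticeQCDFlow.Theory2.Autoregressive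

end
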